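import Summits.ABC.ABC.Theorems.CongruentialReceptacleTameLocalReceptacleDefs

/-!
# Crux `TameLocalReceptacle` (stmt-ABC-14354): the ONE-SIDED receptacle is exactly the Target

Redirect strategist r1 (planner-cstrat-stmt-ABC-14354-r1-0, 2026-08-17), banked artefact of the census
`Cruxes/TameLocalReceptacle/STRATEGY-CENSUS.md` (readable copy with named defs:
`Cruxes/TameLocalReceptacle/StrategistR1Costume.lean`).

By `stub_tlr_iff_itr` (p115028) the crux is `IntegerTameReceptacle`: ONE windowed integer table `t` with
`|recSum t (a,b,c)| ≤ c₃` on the `κ`-balanced cell.  Split the absolute value into its two sides.  This file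
proves, sorry-free and def-free (statements spelled out over the Defs vocabulary `Table`, `InWindow`,
`IsBalanced`, `recSum`):

* `balancedFreySzpiro_iff_oneSidedReceptacle` — the UPPER side alone (`recSum t ≤ c₃`, the side the glue
  `TameLocalReceptacleGivesTarget_proof` consumes) is EQUIVALENT to the Target `BalancedFreySzpiro`
  (`→`: sum the lower windows; `←`: take the table AT its lower window `⌈(2(i+j+k) − 6 − ε) log p⌉` and absorb
  the rounding into the `ε`-room at every prime `p ≥ e^{2/ε}`, paying `1` at each smaller prime);
* `lowerSidedReceptacle_trivial` — the LOWER side alone (`−c₃ ≤ recSum t`) holds trivially (table at the top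
  of its window);
* `integerTameReceptacle_sides` — the crux gives both sides with the SAME table.

Reading (the census's costume theorem): the crux = (Target on the compact cell) + (the certifying table is ALSO
bounded below on every balanced triple); the second clause is inseparable from the first (with separate tables
it is `lowerSidedReceptacle_trivial`), and as a property of the same table it is refuted in every structured
class (`not_tameLocalReceptacle_kummerLocal` p118459, `not_tameLocalReceptacle_quadraticLocal` p118031,
`no_nearResidueFree_itr` p116469) and modulo EH / MF for the literal class (p116736, p121503).
-/

-- `Summit.<Summit>.<Problem>` is the mandated summit-side namespace (CONVENTIONS §2); for the
-- single-conjunct summit `ABC` the two coincide, so the duplicate `ABC.ABC` is deliberate.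
set_option linter.dupNamespace false

namespace Summit.ABC.ABC.Theorems.TameLocalReceptacle

open Summit.ABC.ABC.Theses.CongruentialReceptacle
open Literature.NumberTheory.DiophantineGeometry (rad rad_def)

/-- Window bookkeeping for the table AT its lower window, `t := ⌈(2m − 6 − ε) log p⌉`:
it lies in the crux's window with `c₁ = 1`, `c₁' = 10 + ε`. [folklore] -/
theorem ceil_window {ε : ℝ} (hε : 0 < ε) {p : ℕ} (hp : p.Prime) (m : ℕ) :
    1 * (2 * (m : ℝ) - 6 - ε) * Real.log p ≤ ((⌈(2 * (m : ℝ) - 6 - ε) * Real.log p⌉ : ℤ) : ℝ) ∧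
    |((⌈(2 * (m : ℝ) - 6 - ε) * Real.log p⌉ : ℤ) : ℝ)| ≤ (10 + ε) * ((m : ℝ) + 1) * Real.log p := by
  have h2 : (2 : ℝ) ≤ p := by exact_mod_cast hp.two_le
  have hmono : Real.log 2 ≤ Real.log p := Real.log_le_log (by norm_num) h2
  have hl2 := Real.log_two_gt_d9
  have hm0 : (0 : ℝ) ≤ (m : ℝ) := Nat.cast_nonneg m
  generalize (m : ℝ) = M at *
  generalize Real.log (p : ℝ) = L at *
  have hL : (1 / 2 : ℝ) < L := by linarith
  have hL0 : 0 ≤ L := by linarith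
  have hc1 : (2 * M - 6 - ε) * L ≤ ((⌈(2 * M - 6 - ε) * L⌉ : ℤ) : ℝ) := Int.le_ceil _
  have hc2 : ((⌈(2 * M - 6 - ε) * L⌉ : ℤ) : ℝ) < (2 * M - 6 - ε) * L + 1 := Int.ceil_lt_add_one _
  have hML : 0 ≤ M * L := mul_nonneg hm0 hL0
  have hεL : 0 ≤ ε * L := mul_nonneg hε.le hL0
  have hεML : 0 ≤ ε * M * L := mul_nonneg (mul_nonneg hε.le hm0) hL0
  constructor
  · linarith
  · rw [abs_le]
    constructor <;> nlinarith

/-- Rounding costs at most `(ε/2) log p` at a prime with `log p ≥ 2/ε`, and at most `1` at the finitely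
many smaller primes. [folklore] -/
theorem ceil_le_half {ε : ℝ} (hε : 0 < ε) (p : ℕ) (m : ℕ) :
    ((⌈(2 * (m : ℝ) - 6 - ε) * Real.log p⌉ : ℤ) : ℝ) ≤
      (2 * (m : ℝ) - 6 - ε / 2) * Real.log p + (if Real.log (p : ℝ) < 2 / ε then 1 else 0) := by
  have hc2 : ((⌈(2 * (m : ℝ) - 6 - ε) * Real.log p⌉ : ℤ) : ℝ) < (2 * (m : ℝ) - 6 - ε) * Real.log p + 1 :=
    Int.ceil_lt_add_one _
  have hL0 : 0 ≤ Real.log (p : ℝ) := Real.log_natCast_nonneg p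
  have hεL : 0 ≤ ε * Real.log (p : ℝ) := mul_nonneg hε.le hL0
  split_ifs with hsmall
  · nlinarith
  · have h2 : 2 ≤ Real.log (p : ℝ) * ε := (div_le_iff₀ hε).mp (not_lt.mp hsmall)
    nlinarith

/-- `→` of the costume theorem: summing the lower window over `p ∣ abc` gives
`c₁ (2 log(abc) − (6+ε) log rad(abc)) ≤ recSum t ≤ c₃`, i.e. `(abc)² ≤ e^{c₃/c₁}·rad^{6+ε}` — the computation
inside `TameLocalReceptacleGivesTarget_proof` with the modulus removed. [folklore] -/
theorem balancedFreySzpiro_of_oneSidedReceptacle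
    (h : (∀ κ : ℝ, 0 < κ → ∀ ε : ℝ, 0 < ε → ∃ c₁ c₁' c₃ : ℝ, 0 < c₁ ∧ ∃ t : Table, InWindow ε c₁ c₁' t ∧
      ∀ a b c : ℕ, IsBalanced κ a b c → (recSum t a b c : ℝ) ≤ c₃)) :
    BalancedFreySzpiro := by
  intro κ hκ ε hε
  obtain ⟨c₁, c₁', c₃, hc₁, t, ht, hb⟩ := h κ hκ ε hε
  refine ⟨Real.exp (c₃ / c₁), ?_⟩
  intro a b c habc hκa hκb
  have ha0 : a ≠ 0 := Nat.pos_iff_ne_zero.mp habc.1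
  have hb0 : b ≠ 0 := Nat.pos_iff_ne_zero.mp habc.2.1
  have hc0 : c ≠ 0 := by
    have := habc.2.2.1
    omega
  have hN0 : a * b * c ≠ 0 := mul_ne_zero (mul_ne_zero ha0 hb0) hc0
  have hNpos : (0 : ℝ) < ((a * b * c : ℕ) : ℝ) := by exact_mod_cast Nat.pos_of_ne_zero hN0
  have hRpos : (0 : ℝ) < ((rad a b c : ℕ) : ℝ) := by
    have h0 : 0 < rad a b c := by
      rw [rad_def]
      exact Nat.pos_of_ne_zero UniqueFactorizationMonoid.radical_ne_zero
    exact_mod_cast h0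
  have hfac : ∀ p : ℕ, a.factorization p + b.factorization p + c.factorization p
      = (a * b * c).factorization p := by
    intro p
    simp only [Nat.factorization_mul (mul_ne_zero ha0 hb0) hc0, Nat.factorization_mul ha0 hb0,
      Finsupp.coe_add, Pi.add_apply]
  have hlogN : ∑ p ∈ (a * b * c).primeFactors, (((a * b * c).factorization p : ℕ) : ℝ) * Real.log p
      = Real.log ((a * b * c : ℕ) : ℝ) := by
    rw [Real.log_nat_eq_sum_factorization, Finsupp.sum, Nat.support_factorization]
  have hlogR : ∑ p ∈ (a * b * c).primeFactors, Real.log p = Real.log ((rad a b c : ℕ) : ℝ) := by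
    rw [rad_def, Nat.radical_eq_prod_primeFactors, Nat.cast_prod, Real.log_prod]
    intro p hp
    exact_mod_cast (Nat.prime_of_mem_primeFactors hp).ne_zero
  have hSle : (recSum t a b c : ℝ) ≤ c₃ := hb a b c ⟨habc, hκa, hκb⟩
  have hSlow : ∑ p ∈ (a * b * c).primeFactors, c₁ * (2 * ((a.factorization p + b.factorization p
      + c.factorization p : ℕ) : ℝ) - 6 - ε) * Real.log p ≤ (recSum t a b c : ℝ) := by
    rw [recSum, Int.cast_sum]
    exact Finset.sum_le_sum fun p hp => (ht p _ _ _ _ _ _ (Nat.prime_of_mem_primeFactors hp)).1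
  have hlow_eq : ∑ p ∈ (a * b * c).primeFactors, c₁ * (2 * ((a.factorization p + b.factorization p
      + c.factorization p : ℕ) : ℝ) - 6 - ε) * Real.log p
      = c₁ * (2 * Real.log ((a * b * c : ℕ) : ℝ) - (6 + ε) * Real.log ((rad a b c : ℕ) : ℝ)) := by
    rw [← hlogN, ← hlogR, Finset.mul_sum, Finset.mul_sum, ← Finset.sum_sub_distrib, Finset.mul_sum]
    refine Finset.sum_congr rfl fun p _ => ?_
    rw [hfac p]
    ring
  have hkey : c₁ * (2 * Real.log ((a * b * c : ℕ) : ℝ) - (6 + ε) * Real.log ((rad a b c : ℕ) : ℝ)) ≤ c₃ := by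
    rw [← hlow_eq]
    exact hSlow.trans hSle
  have hkey' : 2 * Real.log ((a * b * c : ℕ) : ℝ)
      ≤ (6 + ε) * Real.log ((rad a b c : ℕ) : ℝ) + c₃ / c₁ := by
    have h1 : 2 * Real.log ((a * b * c : ℕ) : ℝ) - (6 + ε) * Real.log ((rad a b c : ℕ) : ℝ) ≤ c₃ / c₁ := by
      rw [le_div_iff₀ hc₁]
      linarith
    linarith
  have hN2 : ((a * b * c : ℕ) : ℝ) ^ 2 = Real.exp (2 * Real.log ((a * b * c : ℕ) : ℝ)) := by
    rw [show (2 : ℝ) * Real.log ((a * b * c : ℕ) : ℝ) = ((2 : ℕ) : ℝ) * Real.log ((a * b * c : ℕ) : ℝ) by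
      norm_num, Real.exp_nat_mul, Real.exp_log hNpos]
  rw [hN2, Real.rpow_def_of_pos hRpos, ← Real.exp_add]
  exact Real.exp_le_exp.mpr (by linarith)

/-- `←` of the costume theorem: given the Target at `(κ, ε/2)` with constant `C`, the table AT its lower
window, `t := ⌈(2(i+j+k) − 6 − ε) log p⌉` (`c₁ = 1`, `c₁' = 10 + ε`), has
`recSum t ≤ 2 log(abc) − (6 + ε/2) log rad(abc) + #{p ∣ abc : log p < 2/ε} ≤ log (max C 1) + e^{2/ε} + 1`
on every `κ`-balanced triple: the rounding is absorbed by the `ε`-room at every prime `p ≥ e^{2/ε}`. [folklore] -/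
theorem oneSidedReceptacle_of_balancedFreySzpiro (h : BalancedFreySzpiro) :
    (∀ κ : ℝ, 0 < κ → ∀ ε : ℝ, 0 < ε → ∃ c₁ c₁' c₃ : ℝ, 0 < c₁ ∧ ∃ t : Table, InWindow ε c₁ c₁' t ∧
      ∀ a b c : ℕ, IsBalanced κ a b c → (recSum t a b c : ℝ) ≤ c₃) := by
  intro κ hκ ε hε
  obtain ⟨C, hC⟩ := h κ hκ (ε / 2) (by positivity)
  refine ⟨1, 10 + ε, Real.log (max C 1) + ((⌊Real.exp (2 / ε)⌋₊ + 1 : ℕ) : ℝ), one_pos,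
    fun p i j k _ _ _ => ⌈(2 * ((i + j + k : ℕ) : ℝ) - 6 - ε) * Real.log p⌉, ?_, ?_⟩
  · intro p i j k r s z hp
    exact ceil_window hε hp (i + j + k)
  · rintro a b c ⟨habc, hκa, hκb⟩
    have ha0 : a ≠ 0 := Nat.pos_iff_ne_zero.mp habc.1
    have hb0 : b ≠ 0 := Nat.pos_iff_ne_zero.mp habc.2.1
    have hc0 : c ≠ 0 := by
      have := habc.2.2.1
      omega
    have hN0 : a * b * c ≠ 0 := mul_ne_zero (mul_ne_zero ha0 hb0) hc0
    have hNpos : (0 : ℝ) < ((a * b * c : ℕ) : ℝ) := by exact_mod_cast Nat.pos_of_ne_zero hN0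
    have hRpos : (0 : ℝ) < ((rad a b c : ℕ) : ℝ) := by
      have h0 : 0 < rad a b c := by
        rw [rad_def]
        exact Nat.pos_of_ne_zero UniqueFactorizationMonoid.radical_ne_zero
      exact_mod_cast h0
    have hfac : ∀ p : ℕ, a.factorization p + b.factorization p + c.factorization p
        = (a * b * c).factorization p := by
      intro p
      simp only [Nat.factorization_mul (mul_ne_zero ha0 hb0) hc0, Nat.factorization_mul ha0 hb0,
        Finsupp.coe_add, Pi.add_apply]
    have hlogN : ∑ p ∈ (a * b * c).primeFactors, (((a * b * c).factorization p : ℕ) : ℝ) * Real.log p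
        = Real.log ((a * b * c : ℕ) : ℝ) := by
      rw [Real.log_nat_eq_sum_factorization, Finsupp.sum, Nat.support_factorization]
    have hlogR : ∑ p ∈ (a * b * c).primeFactors, Real.log p = Real.log ((rad a b c : ℕ) : ℝ) := by
      rw [rad_def, Nat.radical_eq_prod_primeFactors, Nat.cast_prod, Real.log_prod]
      intro p hp
      exact_mod_cast (Nat.prime_of_mem_primeFactors hp).ne_zero
    -- the Target, logarithmically
    have hmaxpos : 0 < max C 1 := lt_of_lt_of_le one_pos (le_max_right _ _)
    have hC1 : ((a * b * c : ℕ) : ℝ) ^ 2 ≤ max C 1 * ((rad a b c : ℕ) : ℝ) ^ (6 + ε / 2) :=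
      (hC a b c habc hκa hκb).trans
        (mul_le_mul_of_nonneg_right (le_max_left _ _) (Real.rpow_nonneg hRpos.le _))
    have hlog2 : 2 * Real.log ((a * b * c : ℕ) : ℝ)
        ≤ Real.log (max C 1) + (6 + ε / 2) * Real.log ((rad a b c : ℕ) : ℝ) := by
      have h1 : Real.log (((a * b * c : ℕ) : ℝ) ^ 2)
          ≤ Real.log (max C 1 * ((rad a b c : ℕ) : ℝ) ^ (6 + ε / 2)) :=
        Real.log_le_log (by positivity) hC1
      rw [Real.log_pow, Nat.cast_ofNat, Real.log_mul hmaxpos.ne' (Real.rpow_pos_of_pos hRpos _).ne',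
        Real.log_rpow hRpos] at h1
      linarith
    -- per-prime rounding bound, summed
    have hper : ∀ p ∈ (a * b * c).primeFactors,
        ((⌈(2 * ((a.factorization p + b.factorization p + c.factorization p : ℕ) : ℝ) - 6 - ε)
            * Real.log p⌉ : ℤ) : ℝ)
          ≤ (2 * ((a.factorization p + b.factorization p + c.factorization p : ℕ) : ℝ) - 6 - ε / 2)
              * Real.log p + (if Real.log (p : ℝ) < 2 / ε then 1 else 0) :=
      fun p _ => ceil_le_half hε p _
    have hsum1 := Finset.sum_le_sum hper
    rw [Finset.sum_add_distrib] at hsum1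
    have hmain : ∑ p ∈ (a * b * c).primeFactors,
        (2 * ((a.factorization p + b.factorization p + c.factorization p : ℕ) : ℝ) - 6 - ε / 2) * Real.log p
        = 2 * Real.log ((a * b * c : ℕ) : ℝ) - (6 + ε / 2) * Real.log ((rad a b c : ℕ) : ℝ) := by
      rw [← hlogN, ← hlogR, Finset.mul_sum, Finset.mul_sum, ← Finset.sum_sub_distrib]
      refine Finset.sum_congr rfl fun p _ => ?_
      rw [hfac p]
      ring
    have hsmall : ∑ p ∈ (a * b * c).primeFactors, (if Real.log (p : ℝ) < 2 / ε then (1 : ℝ) else 0)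
        ≤ ((⌊Real.exp (2 / ε)⌋₊ + 1 : ℕ) : ℝ) := by
      rw [Finset.sum_boole]
      have hsub : ((a * b * c).primeFactors.filter (fun p : ℕ => Real.log (p : ℝ) < 2 / ε))
          ⊆ Finset.range (⌊Real.exp (2 / ε)⌋₊ + 1) := by
        intro p hp
        rw [Finset.mem_filter] at hp
        rw [Finset.mem_range]
        have hp0 : (0 : ℝ) < p := by exact_mod_cast (Nat.prime_of_mem_primeFactors hp.1).pos
        have hlt : (p : ℝ) < Real.exp (2 / ε) := by
          rw [← Real.exp_log hp0]
          exact Real.exp_lt_exp.mpr hp.2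
        have : p ≤ ⌊Real.exp (2 / ε)⌋₊ := Nat.le_floor hlt.le
        omega
      exact_mod_cast (Finset.card_le_card hsub).trans (Finset.card_range _).le
    rw [recSum, Int.cast_sum]
    linarith [hsum1, hmain, hsmall, hlog2]

/-- COSTUME THEOREM: the Target `BalancedFreySzpiro` (Szpiro `6+ε` in elementary currency on the compactly
balanced cell) is EQUIVALENT to the one-sided single-table tame receptacle.  Hence the crux
`TameLocalReceptacle` (⇔ `IntegerTameReceptacle`, `stub_tlr_iff_itr`) says exactly: "the Target, AND the table
that certifies it is also bounded BELOW on every balanced triple". [folklore] -/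
theorem balancedFreySzpiro_iff_oneSidedReceptacle : Summit.ABC.ABC.Theses.CongruentialReceptacle.BalancedFreySzpiro ↔ (∀ κ : ℝ, 0 < κ → ∀ ε : ℝ, 0 < ε → ∃ c₁ c₁' c₃ : ℝ, 0 < c₁ ∧ ∃ t : Summit.ABC.ABC.Theorems.TameLocalReceptacle.Table, Summit.ABC.ABC.Theorems.TameLocalReceptacle.InWindow ε c₁ c₁' t ∧ ∀ a b c : ℕ, Summit.ABC.ABC.Theorems.TameLocalReceptacle.IsBalanced κ a b c → (Summit.ABC.ABC.Theorems.TameLocalReceptacle.recSum t a b c : ℝ) ≤ c₃) :=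
  ⟨oneSidedReceptacle_of_balancedFreySzpiro, balancedFreySzpiro_of_oneSidedReceptacle⟩

/-- The lower side alone is TRIVIAL (sketch): `c₁ := 1`, `c₁' := 2`, `c₃ := 0`,
`t p i j k _ _ _ := ⌊2((i+j+k)+1) log p⌋`; the window holds since `2(m+1) log p − 1 ≥ (2m − 6 − ε) log p`
and `⌊2(m+1) log p⌋ ≥ ⌊2 log 2⌋ = 1 > 0`, so every `recSum t ≥ 0`. [folklore] -/
theorem lowerSidedReceptacle_trivial :
    ∀ κ : ℝ, 0 < κ → ∀ ε : ℝ, 0 < ε → ∃ c₁ c₁' c₃ : ℝ, 0 < c₁ ∧ ∃ t : Table, InWindow ε c₁ c₁' t ∧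
      ∀ a b c : ℕ, IsBalanced κ a b c → -c₃ ≤ (recSum t a b c : ℝ) := by
  intro κ _hκ ε hε
  refine ⟨1, 2, 0, one_pos,
    fun p i j k _ _ _ => ⌊(2 : ℝ) * (((i + j + k : ℕ) : ℝ) + 1) * Real.log p⌋, ?_, ?_⟩
  · intro p i j k r s z hp
    dsimp only
    have h2 : (2 : ℝ) ≤ p := by exact_mod_cast hp.two_le
    have hmono : Real.log 2 ≤ Real.log p := Real.log_le_log (by norm_num) h2
    have hl2 := Real.log_two_gt_d9
    have hm0 : (0 : ℝ) ≤ ((i + j + k : ℕ) : ℝ) := by positivity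
    generalize ((i + j + k : ℕ) : ℝ) = m at *
    generalize Real.log (p : ℝ) = L at *
    have hL : (1 / 2 : ℝ) < L := by linarith
    have hL0 : 0 ≤ L := by linarith
    have hx0 : 0 ≤ (2 : ℝ) * (m + 1) * L := by positivity
    have hfl : ((⌊(2 : ℝ) * (m + 1) * L⌋ : ℤ) : ℝ) ≤ (2 : ℝ) * (m + 1) * L := Int.floor_le _
    have hfl' : (2 : ℝ) * (m + 1) * L < ((⌊(2 : ℝ) * (m + 1) * L⌋ : ℤ) : ℝ) + 1 :=
      Int.lt_floor_add_one _
    have hflnn : (0 : ℝ) ≤ ((⌊(2 : ℝ) * (m + 1) * L⌋ : ℤ) : ℝ) := by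
      exact_mod_cast Int.floor_nonneg.mpr hx0
    have hεL : 0 ≤ ε * L := mul_nonneg hε.le hL0
    have hmL : 0 ≤ m * L := mul_nonneg hm0 hL0
    constructor
    · nlinarith
    · rw [abs_of_nonneg hflnn]
      nlinarith
  · intro a b c _habc
    simp only [neg_zero, recSum]
    push_cast
    refine Finset.sum_nonneg fun p hp => ?_
    have hx0 : 0 ≤ (2 : ℝ) * ((((a.factorization p + b.factorization p + c.factorization p : ℕ)) : ℝ) + 1)
        * Real.log p := by
      have : 0 ≤ Real.log (p : ℝ) := Real.log_natCast_nonneg p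
      positivity
    exact_mod_cast Int.floor_nonneg.mpr hx0


/-- The crux's modulus-free form gives both sides with the SAME table (`abs_le`). [folklore] -/
theorem integerTameReceptacle_sides (h : IntegerTameReceptacle) :
    (∀ κ : ℝ, 0 < κ → ∀ ε : ℝ, 0 < ε → ∃ c₁ c₁' c₃ : ℝ, 0 < c₁ ∧ ∃ t : Table, InWindow ε c₁ c₁' t ∧
      ∀ a b c : ℕ, IsBalanced κ a b c → (recSum t a b c : ℝ) ≤ c₃) ∧
    (∀ κ : ℝ, 0 < κ → ∀ ε : ℝ, 0 < ε → ∃ c₁ c₁' c₃ : ℝ, 0 < c₁ ∧ ∃ t : Table, InWindow ε c₁ c₁' t ∧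
      ∀ a b c : ℕ, IsBalanced κ a b c → -c₃ ≤ (recSum t a b c : ℝ)) := by
  refine ⟨fun κ hκ ε hε => ?_, fun κ hκ ε hε => ?_⟩
  · obtain ⟨c₁, c₁', c₃, hc₁, t, hw, hb⟩ := h κ hκ ε hε
    exact ⟨c₁, c₁', c₃, hc₁, t, hw, fun a b c habc => (abs_le.mp (hb a b c habc)).2⟩
  · obtain ⟨c₁, c₁', c₃, hc₁, t, hw, hb⟩ := h κ hκ ε hε
    exact ⟨c₁, c₁', c₃, hc₁, t, hw, fun a b c habc => (abs_le.mp (hb a b c habc)).1⟩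

end Summit.ABC.ABC.Theorems.TameLocalReceptacle
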